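import Literature.NumberTheory.GelbartRogawski1991.LocalDoubledRationalSimilitudeSiegel
import Literature.NumberTheory.GelbartRogawski1991.LocalScaleModelTransport
import Literature.NumberTheory.Automorphic.UnitaryGroupSeesawConjugation
import HarnessLib

/-!
# The symplectic element `P = Res(k ⊕ k) ∘ Λ_{m₀}⁻¹ ∈ Sp(𝕎^𝔻_v)` of a rational similitude: it preserves `ℓ_Δ` and conjugates `ι^𝔻_{δ/m₀}` to `ι^𝔻_δ ∘ Ad(k ⊕ k)`

Topic `NumberTheory/GelbartRogawski1991`; namespace `Literature.NumberTheory.GelbartRogawski1991.UnitaryDualPair.LocalSplitting`.  KERNEL ONLY: theorems; no definition,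
no named fact, no `sorry`.  Cell `hodgecm-mathlib` (D-0151), programme P5 (crux HLiu418 = stmt-HodgeConjecture-24832), piece **P3b** of the road card
`F0/P5/A-p18/g23/ROAD-L4if-v2.A-p18g23.md` §4 (A-p18 (g23), 2026-08-31), sequel of ★ P3a `LocalDoubledRationalSimilitudeSiegel`.

SETTING: `k₀ ∈ GL_n(F)` with `ᵗk₀ T₀ k₀ = m₀ T₀` (`m₀ ∈ Fˣ`), `KD = (k₀ ⊕ k₀) ⊗ 1 ∈ GL_{n+n}(E)`, `T₀′ = m₀ T₀` (so `T^𝔻′ = m₀ T^𝔻`), `Ad(KD) =` ★ `localCongr E c KD`.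
* §1 `Res(KD_v)(x, y) = (KD₀ x, KD₀ y)` on `𝕎^𝔻_v = F_v^{n+n} × F_v^{n+n}` (★ `resAut_map`: a RATIONAL matrix acts diagonally on the polarisation `X ⊕ Y`);
  `KD_v : (𝕎^𝔻, β_{m₀T^𝔻}) → (𝕎^𝔻, β_{T^𝔻})` is an isometry (`isometry_toLocalGL_kd`).
* §2 **`P := Res(KD_v) ∘ e′_{m₀}⁻¹ ∈ Sp(𝕎^𝔻_v, β_{T^𝔻})`** (`exists_symplectic_kd`; `e′_{m₀} : (x, y) ↦ (x, m₀ y)` is ★ `lineScale`, the see-saw element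
  `Res(g) ∘ Λ_C⁻¹` of ★ `IsQuadraticCoordinates.seesawConj` at `C = m₀ • 1`): an HONEST symplectic element although `Res(KD_v)` alone is only a similitude;
* §3 **`P ℓ_Δ = ℓ_Δ`** (`map_deltaLagrangian_symplectic_kd`): `KD₀ = k₀ ⊕ k₀` acts on both halves by `k₀`, `e′` by a scalar on `Y`;
* §4 **`P · ι^𝔻_{δ/m₀}(g) · P⁻¹ = ι^𝔻_δ(KD g KD⁻¹)`** (`conj_iota_lineDelta_eq_iota_localCongr_kd`): with ★ `symplecticConj_lineScale_iota_scaleInl`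
  (`ι_{δ/m₀} = e′ ι^{m₀T^𝔻}_δ e′⁻¹`) both sides are `Res(KD_v g KD_v⁻¹)`.
With ★ P3a these are all the inputs of the Kudla-rigidity transport of the `χ`-normalised doubled section along `Ad(KD)` (P3c).  Nothing of the cited sources
is asserted; HC_CM is proved only modulo the printed citations until rung 0 closes.

## References
* [Kudla1994] S. Kudla, Israel J. Math. 87 (1994), §2, §3 Thm. 3.1.
* [Kudla1984] S. Kudla, Seesaw dual reductive pairs (1984), §1 (the see-saw conjugation).
* [MoeglinVignerasWaldspurger1987] LNM 1291 (1987), Chap. 1 I.17, Chap. 2 II.1, Chap. 3 I.1–I.3.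
* [Weil1964] A. Weil, Acta Math. 111 (1964), n° 34 p. 182.
* [HarrisKudlaSweet1996] J. AMS 9 (1996), §1 (1.9)–(1.11).
-/

set_option autoImplicit false
-- buildfix G11b-3 recipe (LEDGER B13-1/B13-3), as in the GelbartRogawski1991 siblings: elaborate sequentially.
set_option Elab.async false

noncomputable section

open scoped Matrix
open NumberField IsDedekindDomain Matrix
open Literature.RepresentationTheory.HeisenbergGroup
open Literature.NumberTheory.Automorphic Literature.NumberTheory.Automorphic.UnitaryGroup Literature.NumberTheory.Weil1964

namespace Literature.NumberTheory.GelbartRogawski1991.UnitaryDualPair.LocalSplitting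

variable (F : Type) [Field F] [NumberField F] (E : Type) [Field E] [NumberField E] [Algebra F E] [Algebra.IsQuadraticExtension F E]
  (c : E ≃ₐ[F] E) (v : HeightOneSpectrum (𝓞 F)) (n : ℕ)
  {δ : E} (hcδ : c δ = -δ) (hδ : δ ≠ 0) {d : F} (hd : δ * δ = algebraMap F E d)
  {T₀ T₀' : Matrix (Fin n) (Fin n) F} (hT₀ : T₀.IsSymm) (hT₀' : T₀'.IsSymm) (m₀ : Fˣ) (hTT₀ : T₀' = (m₀ : F) • T₀)
  {JD JD' : Matrix (Fin (n + n)) (Fin (n + n)) E} (hJD : JD = (gramD F n T₀).map (algebraMap F E))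
  (hJD' : JD' = (gramD F n T₀').map (algebraMap F E))
  (k₀ : GL (Fin n) F) (hk₀ : ((k₀ : Matrix (Fin n) (Fin n) F))ᵀ * T₀ * (k₀ : Matrix (Fin n) (Fin n) F) = (m₀ : F) • T₀)
  {KD : GL (Fin (n + n)) E}
  (hKD : KD = Matrix.GeneralLinearGroup.map (algebraMap F E) (UnitaryGroup.reindexGL (e₂ n) (UnitaryGroup.blockDiagGL (k₀, k₀))))
  {a : E} (ha : a ≠ 0) (hKDJ : formCongr (c : E →+* E) KD (a • JD) = JD)

/-! ## §1 `Res` of a rational matrix; `KD_v` is an isometry `β_{m₀T^𝔻} → β_{T^𝔻}` -/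

omit [NumberField F] in
/-- coercion of `GeneralLinearGroup.map` (definitional). [folklore] -/
private theorem coe_glMap' {R S : Type*} [CommRing R] [CommRing S] {l : Type*} [Fintype l] [DecidableEq l] (f : R →+* S) (g : GL l R) :
    ((Matrix.GeneralLinearGroup.map f g : GL l S) : Matrix l l S) = (g : Matrix l l R).map f := rfl

omit [Algebra.IsQuadraticExtension F E] in
/-- a RATIONAL matrix read in `GL_N(E ⊗ F_v)` is the `F_v`-matrix read through `ι_v : F_v → E ⊗ F_v`. [folklore] -/
private theorem toLocalGL_map_eq {N : ℕ} (B₀ : GL (Fin N) F) :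
    toLocalGL E v (Matrix.GeneralLinearGroup.map (algebraMap F E) B₀) =
      Matrix.GeneralLinearGroup.map (toLocalRing E v) (Matrix.GeneralLinearGroup.map (algebraMap F (v.adicCompletion F)) B₀) := by
  refine Units.ext (Matrix.ext fun i j => ?_)
  exact (toLocalRing_coe E v ((B₀ : Matrix (Fin N) (Fin N) F) i j)).symm

/-- **`Res(B_v)(x, y) = (B₀ x, B₀ y)`** for a rational `B = B₀ ⊗ 1 ∈ GL_N(E)`: it preserves the polarisation `X ⊕ Y` of `𝕎_v`. [cite: MoeglinVignerasWaldspurger1987, Chap. 1 I.17] -/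
theorem resAut_toLocalGL_map (N : ℕ) (B₀ : GL (Fin N) F) (p q : Fin N → v.adicCompletion F) :
    (isQuadraticCoordinates_local E v c hcδ hδ hd).resAut (Fin N) (toLocalGL E v (Matrix.GeneralLinearGroup.map (algebraMap F E) B₀)) (p, q) =
      (((B₀ : Matrix (Fin N) (Fin N) F)).map (algebraMap F (v.adicCompletion F)) *ᵥ p,
        ((B₀ : Matrix (Fin N) (Fin N) F)).map (algebraMap F (v.adicCompletion F)) *ᵥ q) := by
  rw [toLocalGL_map_eq]
  exact (isQuadraticCoordinates_local E v c hcδ hδ hd).resAut_map (Fin N) _ p q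

omit [Algebra.IsQuadraticExtension F E] in
include hk₀ hKD hTT₀ in
/-- **`KD_v` is an isometry `(E_v^{n+n}, m₀ J^𝔻) → (E_v^{n+n}, J^𝔻)`** read on the local form matrices `𝕋^𝔻_v ⊗ 1`, `𝕋^𝔻′_v ⊗ 1` (`T₀′ = m₀T₀`).
[cite: MoeglinVignerasWaldspurger1987, Chap. 1 I.17] [cite: HarrisKudlaSweet1996, §1 (1.9)] -/
theorem isometry_toLocalGL_kd :
    (((toLocalGL E v KD : GL (Fin (n + n)) (LocalRing E v)) : Matrix (Fin (n + n)) (Fin (n + n)) (LocalRing E v)).map (conjLocal E c v))ᵀ *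
        (localGram F (n + n) (gramD F n T₀) v).map (toLocalRing E v) * (toLocalGL E v KD : GL (Fin (n + n)) (LocalRing E v)) =
      (localGram F (n + n) (gramD F n T₀') v).map (toLocalRing E v) := by
  subst hKD
  rw [toLocalGL_map_eq, coe_glMap', coe_glMap']
  have hcφ : (conjLocal E c v : LocalRing E v → LocalRing E v) ∘ (toLocalRing E v) = toLocalRing E v := funext fun x => conjLocal_toLocalRing c v x
  rw [Matrix.map_map, hcφ, ← Matrix.transpose_map, ← Matrix.map_mul, ← Matrix.map_mul, localGram, ← Matrix.transpose_map, ← Matrix.map_mul,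
    ← Matrix.map_mul, transpose_kd_mul_gramD_mul_kd F n k₀ (m₀ : F) hk₀, localGram_of_eq_smul F (n + n) (gramD F n T₀) (gramD F n T₀') m₀
      (by rw [hTT₀, gramD_smul]) v, localGram, Matrix.map_smul' _ _ _ (map_mul _)]

/-! ## §2 The symplectic element `P = Res(KD_v) ∘ e′_{m₀}⁻¹` -/

include hk₀ hKD hTT₀ hT₀ in
/-- **`P := Res(KD_v) ∘ e′_{m₀}⁻¹` lies in `Sp(𝕎^𝔻_v, β_{T^𝔻})`**: `e′_{m₀}⁻¹` is an isometry `β_{T^𝔻} → β_{m₀T^𝔻}` (★ `polar_localPairing_lineScale_of_eq_smul`)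
and `Res(KD_v)` an isometry `β_{m₀T^𝔻} → β_{T^𝔻}` (★ `alt_polar_resAut`) — the see-saw element `Res(g) ∘ Λ_C⁻¹` at `C = m₀ • 1`.
[cite: Kudla1984, §1] [cite: MoeglinVignerasWaldspurger1987, Chap. 1 I.17] [cite: Weil1964, n° 34 p. 182] -/
theorem exists_symplectic_kd :
    ∃ P : LocalSp F (n + n) (gramD F n T₀) v,
      ((P : ((Fin (n + n) → v.adicCompletion F) × (Fin (n + n) → v.adicCompletion F)) ≃ₗ[v.adicCompletion F]
          ((Fin (n + n) → v.adicCompletion F) × (Fin (n + n) → v.adicCompletion F))) =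
        (lineScale (unitAt F m₀ v)).symm ≪≫ₗ (isQuadraticCoordinates_local E v c hcδ hδ hd).resAut (Fin (n + n)) (toLocalGL E v KD)) := by
  refine ⟨⟨(lineScale (unitAt F m₀ v)).symm ≪≫ₗ (isQuadraticCoordinates_local E v c hcδ hδ hd).resAut (Fin (n + n)) (toLocalGL E v KD), ?_⟩, rfl⟩
  rw [mem_symplecticGroup]
  intro w w'
  have hres := fun p q => (isQuadraticCoordinates_local E v c hcδ hδ hd).alt_polar_resAut (Fin (n + n))
    ((gramD_isSymm F n hT₀).map (algebraMap F (v.adicCompletion F)))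
    ((gramD_isSymm F n (T₀ := T₀') (by rw [hTT₀]; exact hT₀.smul _)).map (algebraMap F (v.adicCompletion F)))
    (σ := conjLocal E c v) (conjLocal_toLocalRing c v) (by rw [conjLocal_algebraMap, hcδ, map_neg]) rfl rfl
    (isometry_toLocalGL_kd F E c v n m₀ hTT₀ k₀ hk₀ hKD) p q
  simp only [alt_apply] at hres
  rw [LinearEquiv.trans_apply, LinearEquiv.trans_apply]
  change polar (localPairing F (n + n) (gramD F n T₀) v) _ _ - polar (localPairing F (n + n) (gramD F n T₀) v) _ _ =
    polar (localPairing F (n + n) (gramD F n T₀) v) _ _ - polar (localPairing F (n + n) (gramD F n T₀) v) _ _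
  rw [localPairing, hres, ← localPairing,
    ← polar_localPairing_lineScale_of_eq_smul F (n + n) (gramD F n T₀) (gramD F n T₀') m₀ (by rw [hTT₀, gramD_smul]) v,
    ← polar_localPairing_lineScale_of_eq_smul F (n + n) (gramD F n T₀) (gramD F n T₀') m₀ (by rw [hTT₀, gramD_smul]) v
      ((lineScale (unitAt F m₀ v)).symm w'),
    LinearEquiv.apply_symm_apply, LinearEquiv.apply_symm_apply]

/-! ## §3 `P` preserves `ℓ_Δ` -/

/-- a vector on `Fin (n + n)` is `Sum.elim` of its halves, read through `e₂`. [folklore] -/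
private theorem comp_e₂_eq_sum_elim (x : Fin (n + n) → v.adicCompletion F) : x ∘ (e₂ n) = Sum.elim (halfL F v n x) (halfR F v n x) := by
  funext s; rcases s with i | i <;> rfl

/-- `(reindex e₂ e₂ (A ⊕ A)) x` has halves `A x_L`, `A x_R`. [folklore] -/
private theorem halves_reindex_fromBlocks_mulVec (A : Matrix (Fin n) (Fin n) (v.adicCompletion F)) (x : Fin (n + n) → v.adicCompletion F) :
    halfL F v n (Matrix.reindex (e₂ n) (e₂ n) (Matrix.fromBlocks A 0 0 A) *ᵥ x) = A *ᵥ halfL F v n x ∧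
      halfR F v n (Matrix.reindex (e₂ n) (e₂ n) (Matrix.fromBlocks A 0 0 A) *ᵥ x) = A *ᵥ halfR F v n x := by
  rw [Matrix.reindex_apply, Matrix.submatrix_mulVec_equiv, Equiv.symm_symm, comp_e₂_eq_sum_elim, Matrix.fromBlocks_mulVec]
  simp only [Matrix.zero_mulVec, add_zero, zero_add]
  exact ⟨funext fun i => by simp only [halfL, Function.comp_apply, Equiv.symm_apply_apply, Sum.elim_inl, Sum.elim_comp_inl],
    funext fun i => by simp only [halfR, Function.comp_apply, Equiv.symm_apply_apply, Sum.elim_inr, Sum.elim_comp_inr]⟩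

/-- `(k ⊕ k, t • (k ⊕ k))` maps `ℓ_Δ` into `ℓ_Δ`. [cite: HarrisKudlaSweet1996, §1 (1.11)] -/
private theorem mem_deltaLagrangian_of_kd (A : Matrix (Fin n) (Fin n) (v.adicCompletion F)) (t : v.adicCompletion F)
    {x y : Fin (n + n) → v.adicCompletion F} (hp : (x, y) ∈ deltaLagrangian F v n) :
    (Matrix.reindex (e₂ n) (e₂ n) (Matrix.fromBlocks A 0 0 A) *ᵥ x, Matrix.reindex (e₂ n) (e₂ n) (Matrix.fromBlocks A 0 0 A) *ᵥ (t • y)) ∈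
      deltaLagrangian F v n := by
  rw [mem_deltaLagrangian_iff] at hp ⊢
  obtain ⟨h1, h2⟩ := hp
  refine ⟨?_, ?_⟩
  · rw [(halves_reindex_fromBlocks_mulVec F v n A x).1, (halves_reindex_fromBlocks_mulVec F v n A x).2]
    exact congrArg _ h1
  · rw [(halves_reindex_fromBlocks_mulVec F v n A _).1, (halves_reindex_fromBlocks_mulVec F v n A _).2]
    have : halfL F v n (t • y) = halfR F v n (t • y) := by
      funext i
      change t * y _ = t * y _
      rw [show y (e₂ n (Sum.inl i)) = halfL F v n y i from rfl, h2]
    rw [this]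

include hKD in
/-- `Res(KD_v)(p, q) = ((k₀ ⊕ k₀) p, (k₀ ⊕ k₀) q)`. [cite: MoeglinVignerasWaldspurger1987, Chap. 1 I.17] -/
theorem resAut_toLocalGL_kd (p q : Fin (n + n) → v.adicCompletion F) :
    (isQuadraticCoordinates_local E v c hcδ hδ hd).resAut (Fin (n + n)) (toLocalGL E v KD) (p, q) =
      (Matrix.reindex (e₂ n) (e₂ n) (Matrix.fromBlocks ((k₀ : Matrix (Fin n) (Fin n) F).map (algebraMap F (v.adicCompletion F))) 0 0
          ((k₀ : Matrix (Fin n) (Fin n) F).map (algebraMap F (v.adicCompletion F)))) *ᵥ p,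
        Matrix.reindex (e₂ n) (e₂ n) (Matrix.fromBlocks ((k₀ : Matrix (Fin n) (Fin n) F).map (algebraMap F (v.adicCompletion F))) 0 0
          ((k₀ : Matrix (Fin n) (Fin n) F).map (algebraMap F (v.adicCompletion F)))) *ᵥ q) := by
  rw [hKD, resAut_toLocalGL_map F E c v hcδ hδ hd (n + n), UnitaryGroup.coe_reindexGL, UnitaryGroup.coe_blockDiagGL, Matrix.reindex_apply,
    Matrix.reindex_apply, ← Matrix.submatrix_map, Matrix.fromBlocks_map, Matrix.map_zero _ (map_zero _)]

include hKD in
/-- `Res(KD_v)⁻¹(p, q) = ((k₀⁻¹ ⊕ k₀⁻¹) p, (k₀⁻¹ ⊕ k₀⁻¹) q)`. [cite: MoeglinVignerasWaldspurger1987, Chap. 1 I.17] -/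
theorem resAut_toLocalGL_kd_inv (p q : Fin (n + n) → v.adicCompletion F) :
    ((isQuadraticCoordinates_local E v c hcδ hδ hd).resAut (Fin (n + n)) (toLocalGL E v KD))⁻¹ (p, q) =
      (Matrix.reindex (e₂ n) (e₂ n) (Matrix.fromBlocks (((k₀⁻¹ : GL (Fin n) F) : Matrix (Fin n) (Fin n) F).map (algebraMap F (v.adicCompletion F))) 0 0
          (((k₀⁻¹ : GL (Fin n) F) : Matrix (Fin n) (Fin n) F).map (algebraMap F (v.adicCompletion F)))) *ᵥ p,
        Matrix.reindex (e₂ n) (e₂ n) (Matrix.fromBlocks (((k₀⁻¹ : GL (Fin n) F) : Matrix (Fin n) (Fin n) F).map (algebraMap F (v.adicCompletion F))) 0 0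
          (((k₀⁻¹ : GL (Fin n) F) : Matrix (Fin n) (Fin n) F).map (algebraMap F (v.adicCompletion F)))) *ᵥ q) := by
  rw [← map_inv, ← map_inv, hKD, ← map_inv, ← map_inv, ← map_inv, Prod.inv_mk]
  exact resAut_toLocalGL_kd F E c v n hcδ hδ hd k₀⁻¹ rfl p q

include hKD in
set_option maxHeartbeats 1600000 in
/-- **`P ℓ_Δ = ℓ_Δ`** for `P = Res(KD_v) ∘ e′_{m₀}⁻¹`. [cite: Kudla1994, §2] [cite: HarrisKudlaSweet1996, §1 (1.11)] -/
theorem map_deltaLagrangian_symplectic_kd (P : LocalSp F (n + n) (gramD F n T₀) v)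
    (hP : ((P : ((Fin (n + n) → v.adicCompletion F) × (Fin (n + n) → v.adicCompletion F)) ≃ₗ[v.adicCompletion F]
          ((Fin (n + n) → v.adicCompletion F) × (Fin (n + n) → v.adicCompletion F))) =
        (lineScale (unitAt F m₀ v)).symm ≪≫ₗ (isQuadraticCoordinates_local E v c hcδ hδ hd).resAut (Fin (n + n)) (toLocalGL E v KD))) :
    (deltaLagrangian F v n).map (toLin F v P) = deltaLagrangian F v n := by
  have key : ∀ p, toLin F v P p =
      (P : ((Fin (n + n) → v.adicCompletion F) × (Fin (n + n) → v.adicCompletion F)) ≃ₗ[v.adicCompletion F] _) p := fun _ => rfl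
  -- the images under `P` and `P⁻¹` of `ℓ_Δ` lie in `ℓ_Δ`
  have hfwd : ∀ x y : Fin (n + n) → v.adicCompletion F, (x, y) ∈ deltaLagrangian F v n →
      (P : ((Fin (n + n) → v.adicCompletion F) × (Fin (n + n) → v.adicCompletion F)) ≃ₗ[v.adicCompletion F] _) (x, y) ∈ deltaLagrangian F v n := by
    intro x y hp
    rw [hP, LinearEquiv.trans_apply, lineScale_symm_apply, resAut_toLocalGL_kd F E c v n hcδ hδ hd k₀ hKD]
    exact mem_deltaLagrangian_of_kd F v n ((k₀ : Matrix (Fin n) (Fin n) F).map (algebraMap F (v.adicCompletion F)))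
      (((unitAt F m₀ v)⁻¹ : (v.adicCompletion F)ˣ) : v.adicCompletion F) hp
  have hbwd : ∀ x y : Fin (n + n) → v.adicCompletion F, (x, y) ∈ deltaLagrangian F v n →
      (P : ((Fin (n + n) → v.adicCompletion F) × (Fin (n + n) → v.adicCompletion F)) ≃ₗ[v.adicCompletion F] _).symm (x, y) ∈
        deltaLagrangian F v n := by
    intro x y hp
    rw [hP, LinearEquiv.trans_symm, LinearEquiv.trans_apply, LinearEquiv.symm_symm]
    have hinv : ((isQuadraticCoordinates_local E v c hcδ hδ hd).resAut (Fin (n + n)) (toLocalGL E v KD)).symm (x, y) =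
        ((isQuadraticCoordinates_local E v c hcδ hδ hd).resAut (Fin (n + n)) (toLocalGL E v KD))⁻¹ (x, y) := rfl
    rw [hinv, resAut_toLocalGL_kd_inv F E c v n hcδ hδ hd k₀ hKD, lineScale_apply, ← Matrix.mulVec_smul]
    exact mem_deltaLagrangian_of_kd F v n (((k₀⁻¹ : GL (Fin n) F) : Matrix (Fin n) (Fin n) F).map (algebraMap F (v.adicCompletion F)))
      ((unitAt F m₀ v : (v.adicCompletion F)ˣ) : v.adicCompletion F) hp
  refine le_antisymm ?_ ?_
  · rintro _ ⟨⟨x, y⟩, hp, rfl⟩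
    rw [key]
    exact hfwd x y hp
  · rintro ⟨x, y⟩ hp
    refine ⟨(P : ((Fin (n + n) → v.adicCompletion F) × (Fin (n + n) → v.adicCompletion F)) ≃ₗ[v.adicCompletion F] _).symm (x, y), ?_, ?_⟩
    · have h := hbwd x y hp
      revert h
      rcases (P : ((Fin (n + n) → v.adicCompletion F) × (Fin (n + n) → v.adicCompletion F)) ≃ₗ[v.adicCompletion F] _).symm (x, y) with ⟨x', y'⟩
      exact id
    · rw [key]
      exact (P : ((Fin (n + n) → v.adicCompletion F) × (Fin (n + n) → v.adicCompletion F)) ≃ₗ[v.adicCompletion F] _).apply_symm_apply (x, y)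

/-! ## §4 `P · ι_{δ/m₀}(g) · P⁻¹ = ι_δ(KD g KD⁻¹)` -/

omit [Algebra.IsQuadraticExtension F E] in
/-- `localPiEquiv (KD u KD⁻¹) = KD_v · localPiEquiv u · KD_v⁻¹` in `GL_{n+n}(E ⊗ F_v)`. [cite: PlatonovRapinchuk1994, §2.3] -/
theorem coe_localPiEquiv_localCongr {N : ℕ} {J J' : Matrix (Fin N) (Fin N) E} (B : GL (Fin N) E) {b : E} (hb : b ≠ 0)
    (h : formCongr (c : E →+* E) B (b • J) = J') (u : localPi E c N J' v) :
    ((localPiEquiv E c N J v (localCongr E c B hb h v u) : «local» E c N J v) : GL (Fin N) (LocalRing E v)) =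
      toLocalGL E v B * ((localPiEquiv E c N J' v u : «local» E c N J' v) : GL (Fin N) (LocalRing E v)) * (toLocalGL E v B)⁻¹ := by
  rw [localCongr, ContinuousMulEquiv.trans_apply, ContinuousMulEquiv.trans_apply, ContinuousMulEquiv.apply_symm_apply,
    ContinuousMulEquiv.coe_restrictSubgroup_apply, GLn.conjEquiv_apply]

/-- the underlying automorphism of `ι_δ(g)` is `Res(localPiEquiv g)`. [cite: MoeglinVignerasWaldspurger1987, Chap. 1 I.17] -/
theorem coe_iota_eq_resAut {N : ℕ} {T : Matrix (Fin N) (Fin N) F} (hT : T.IsSymm) {J : Matrix (Fin N) (Fin N) E} (hJ : J = T.map (algebraMap F E))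
    (g : localPi E c N J v) :
    ((iota F E c N hcδ hδ hd T hT hJ v g : LocalSp F N T v) :
        ((Fin N → v.adicCompletion F) × (Fin N → v.adicCompletion F)) ≃ₗ[v.adicCompletion F] ((Fin N → v.adicCompletion F) × (Fin N → v.adicCompletion F))) =
      (isQuadraticCoordinates_local E v c hcδ hδ hd).resAut (Fin N) ((localPiEquiv E c N J v g : «local» E c N J v) : GL (Fin N) (LocalRing E v)) := by
  rw [iota_def]
  rfl

include hT₀' hTT₀ hJD' in
set_option maxHeartbeats 1600000 in
/-- **`P · ι^𝔻_{δ/m₀}(g) · P⁻¹ = ι^𝔻_δ(KD g KD⁻¹)`** in `Sp(𝕎^𝔻_v, β_{T^𝔻})` for `P = Res(KD_v) ∘ e′_{m₀}⁻¹`: with ★ `symplecticConj_lineScale_iota_scaleInl`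
(`ι_{δ/m₀}(g) = e′ Res(g) e′⁻¹`) both sides are `Res(KD_v g KD_v⁻¹)`. [cite: Kudla1984, §1] [cite: MoeglinVignerasWaldspurger1987, Chap. 1 I.17; Chap. 3 I.1] -/
theorem conj_iota_lineDelta_eq_iota_localCongr_kd (P : LocalSp F (n + n) (gramD F n T₀) v)
    (hP : ((P : ((Fin (n + n) → v.adicCompletion F) × (Fin (n + n) → v.adicCompletion F)) ≃ₗ[v.adicCompletion F]
          ((Fin (n + n) → v.adicCompletion F) × (Fin (n + n) → v.adicCompletion F))) =
        (lineScale (unitAt F m₀ v)).symm ≪≫ₗ (isQuadraticCoordinates_local E v c hcδ hδ hd).resAut (Fin (n + n)) (toLocalGL E v KD)))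
    (g : localPi E c (n + n) JD v) :
    P * iota F E c (n + n) (conj_lineDelta hcδ m₀) (lineDelta_ne_zero hδ m₀) (lineDelta_mul_self hd m₀) (gramD F n T₀) (gramD_isSymm F n hT₀) hJD v g * P⁻¹ =
      iota F E c (n + n) hcδ hδ hd (gramD F n T₀) (gramD_isSymm F n hT₀) hJD v (localCongr E c KD ha hKDJ v g) := by
  apply Subtype.ext
  refine LinearEquiv.ext fun w => ?_
  rw [← symplecticConj_lineScale_iota_scaleInl F E c (n + n) hcδ hδ hd (gramD F n T₀) (gramD F n T₀') (gramD_isSymm F n hT₀) (gramD_isSymm F n hT₀') m₀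
    (by rw [hTT₀, gramD_smul]) hJD hJD' v g]
  rw [Subgroup.coe_mul, Subgroup.coe_mul, Subgroup.coe_inv, LinearEquiv.mul_apply, LinearEquiv.mul_apply, LinearEquiv.coe_inv, symplecticConj_apply,
    coe_iota_eq_resAut, coe_iota_eq_resAut, coe_localPiEquiv_scaleInl, coe_localPiEquiv_localCongr, map_mul, map_mul, map_inv, hP,
    LinearEquiv.trans_symm, LinearEquiv.symm_symm]
  simp only [LinearEquiv.trans_apply, LinearEquiv.symm_apply_apply, LinearEquiv.mul_apply, LinearEquiv.coe_inv]

end Literature.NumberTheory.GelbartRogawski1991.UnitaryDualPair.LocalSplitting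

end
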